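import Summits.BirchSwinnertonDyer.BirchSwinnertonDyer.Theorems.GenusKolyvaginAtTwoShaCardDvdPowAtTwoRTShaSelmerCount
import Summits.BirchSwinnertonDyer.BirchSwinnertonDyer.Theorems.GenusKolyvaginAtTwoPowDvdShaCardAtTwoRTRankZeroSide
import Literature.NumberTheory.EllipticCurves.SelmerGroupCardinality
import Literature.NumberTheory.EllipticCurves.TwistFamilySelmerGroupCardInvarianceProofs
import HarnessLib

/-!
# Route `GenusKolyvaginAtTwo`, crux U_T `ShaCardDvdPowAtTwoRT` (stmt-BirchSwinnertonDyer-23658), LINE 19 `rational_pair_descent` v1.1 —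
# «`Zp = ⊥`»: ON THE LIVE CONFIGURATION THE TWIN'S `2`-PRIMARY Ш IS TRIVIAL, `Ш(Wd/ℚ)[2^∞] = 0`
# (input of SANDWICH′ (A) «τ acts trivially on `Ш(E/K)[2^∞]`», LEAD memo R7 §1a/§1b, and of T4's `Zp`)

Seat `bsd-line-gk2-p5` g29 (WIDTH-5 attach, cell `bsd-f1-sign2`), `--supports stmt-BirchSwinnertonDyer-23658` (helper; closes nothing).
THEOREMS ONLY (no definition, no named fact, no `sorry`).  BSD is NOT proved by any of this; neither is U_T.

WHAT (frame = U_T's rev-37 binders + `W.rootNumber = 1` + an elliptic `ℚ`-model `Wd ≅ E^(d_K)`; Q2 by name; `y_K = P(1)` of infinite order):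
* §1 `mordellWeilRank_rat_eq_zero_and_twin_eq_one_onHabitat` — **`rank E(ℚ) = 0` and `rank Wd(ℚ) = 1`**: `rank E(K) = 1` (gk2-p4 g22
  `mordellWeilRank_baseChange_eq_one_onHabitat`, Kolyvagin's descent AT 2 in the tree), the `K`-rational Heegner point `P₀ ↦ P(1)`, and
  gk2-p2 g18's (R0) `rankZero_side_of_rootNumber` (Gross 5.3: `τP₀ + w P₀` torsion; `w = 1` ⟹ `P₀ − τP₀` anti-fixed of infinite order ⟹
  `rank E^(d) ≥ 1`; `rank E + rank E^(d) = rank E(K) = 1`).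
* §3 `natCard_sha_inf_torsionBy_two_twin_eq_one_onHabitat` — with `#Sel₂(Wd) = 2`: **`Ш(Wd/ℚ)[2] = 0`** (descent count
  `#Sel₂ = 2^rank · #Wd(ℚ)[2] · #Ш[2]`, `card_selmerGroup_eq_pow_rank_mul`: `2 = 2 · (#Wd(ℚ)[2] · #Ш[2])` forces both factors to be `1`).
* §4 **`forall_primaryComponent_sha_twin_two_eq_zero_onHabitat`**, `natCard_primaryComponent_sha_twin_two_eq_one_onHabitat` —
  **`Ш(Wd/ℚ)[2^∞] = 0`** (a `2`-primary group without elements of order `2` is trivial).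

References: [GrossLMS1991] Thm. 1.3, §5 Prop. 5.3; [Kolyvagin1990] Thm. A; [SilvermanAEC2009] Thm. X.4.2, X.5 Cor. 5.4, Exercise 10.16;
[DokchitserDokchitserMathZ2012] Thm. (1); [MazurRubin2010] §1 (2-Selmer-minimal twists).
-/

set_option autoImplicit false
-- the Theorems namespace of this sub repeats the summit name by design (D-0017 nested layout)
set_option linter.dupNamespace false

noncomputable section

open scoped Classical
open scoped AddSubgroup

namespace Summit.BirchSwinnertonDyer.BirchSwinnertonDyer.Theorems.GenusExact.PlusDescent

open WeierstrassCurve NumberField IsDedekindDomain Field Literature.NumberTheory.EllipticCurves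
  Literature.NumberTheory.GaloisRepresentations Literature.NumberTheory.EllipticCurves.ModularForms AddSubgroup
open Summit.BirchSwinnertonDyer.BirchSwinnertonDyer.Theses.GenusKolyvaginAtTwo (KolyvaginRelationAtTwo)
open Summit.BirchSwinnertonDyer.Rank1Residual

/-! ## §1 `rank E(ℚ) = 0`, `rank Wd(ℚ) = 1` on the live configuration -/

/-- **`rank E(ℚ) = 0` and `rank Wd(ℚ) = 1` on U_T's frame with `w(E) = +1`**, for every elliptic `ℚ`-model `Wd` of `E^(d_K)`: `rank E(K) = 1`
(gk2-p4 `mordellWeilRank_baseChange_eq_one_onHabitat`), the `K`-rational Heegner point under `P(1)` is non-torsion, and (R0)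
(`rankZero_side_of_rootNumber`: `w = 1` ⟹ `rank E(ℚ) = 0`); `rank E(ℚ) + rank E^(d_K)(ℚ) = rank E(K)` (`mordellWeilRank_add_eq_of_baseChange`)
and model invariance of the rank. [cite: GrossLMS1991, Thm. 1.3, §5 Prop. 5.3] [cite: Kolyvagin1990, Thm. A] [cite: SilvermanAEC2009, Exercise 10.16] -/
theorem mordellWeilRank_rat_eq_zero_and_twin_eq_one_onHabitat (hQ2 : KolyvaginRelationAtTwo)
    (W : WeierstrassCurve ℚ) [W.IsElliptic] [W.IsGloballyMinimal] [NeZero (W.conductorNorm ℤ)] (hcm : ¬ W.HasCM)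
    (hT : Odd W.tamagawaProduct) (v : HeightOneSpectrum (𝓞 ℚ)) (h2v : ((2 : ℕ) : 𝓞 ℚ) ∉ v.asIdeal)
    (hNv : ((W.conductorNorm ℤ : ℕ) : 𝓞 ℚ) ∈ v.asIdeal) (hmult : W.HasMultiplicativeReductionAt v) (hneg : W.Δ < 0)
    (K : Type) [Field K] [NumberField K] (hIQ : IsImaginaryQuadratic K) (hodd : Odd (NumberField.discr K))
    (h3 : NumberField.discr K ≠ -3) (hHe : SatisfiesHeegnerHypothesis (W.conductorNorm ℤ) K)
    (hsq1 : ¬ IsSquare ((NumberField.discr K : ℚ) * -|W.Δ|)) (hsq2 : ¬ IsSquare ((NumberField.discr K : ℚ) * (-(2 * |W.Δ|))))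
    (hρ : ∀ n : ℕ, 0 < n → W.HasSurjectiveModNGaloisRep ((2 : ℤ) ^ n))
    (Dt : ModularParametrizationData W (W.conductorNorm ℤ)) (β : ℤ) (ι : K →+* ℂ) (d₁ : KolyvaginHeegnerData Dt β ι 1)
    (hnt : ¬ IsOfFinAddOrder d₁.derivedPoint) (M₀ : ℕ)
    (hndiv : ¬ ∃ Q : (W.baseChange (ringClassField K ι 1)).toAffine.Point, ((2 ^ (M₀ + 1) : ℕ) : ℤ) • Q = d₁.derivedPoint)
    (hw1 : W.rootNumber = 1)
    (Wd : WeierstrassCurve ℚ) [Wd.IsElliptic] (hWd : ∃ C : VariableChange ℚ, C • W.quadraticTwist (NumberField.discr K : ℚ) = Wd) :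
    W.mordellWeilRank = 0 ∧ Wd.mordellWeilRank = 1 := by
  haveI hell : (W.baseChange K).IsElliptic := inferInstanceAs ((W.map (algebraMap ℚ K)).IsElliptic)
  have h2 : Module.finrank ℚ K = 2 := hIQ.1
  have hs2 : W.HasSurjectiveModNGaloisRep 2 := by simpa using hρ 1 one_pos
  have hdK : (NumberField.discr K : ℚ) ≠ 0 := by exact_mod_cast NumberField.discr_ne_zero K
  haveI := W.isElliptic_quadraticTwist hdK
  -- `rank E(K) = 1`
  have hrk := mordellWeilRank_baseChange_eq_one_onHabitat hQ2 W hcm hT v h2v hNv hmult hneg K hIQ hodd h3 hHe hsq1 hsq2 hρ Dt β ι d₁ hnt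
    M₀ hndiv
  -- the `K`-rational Heegner point under `P(1)`, of infinite order
  obtain ⟨P₀, hHP, hP₀⟩ := AdditiveKoly.exists_isHeegnerPoint_map_eq_derivedPoint_one (W := W) (K := K) (Dt := Dt) (β := β) (ι := ι)
    hIQ hHe d₁
  have hP₀nt : ¬ IsOfFinAddOrder P₀ := fun h ↦ hnt (by rw [← hP₀]; exact AddMonoidHom.isOfFinAddOrder _ h)
  -- (R0): `w = 1` ⟹ `rank E(ℚ) = 0`
  have hW0 : W.mordellWeilRank = 0 := by
    rcases rankZero_side_of_rootNumber K W hIQ hHe hs2 hrk hHP hP₀nt (Wd := Wd) hWd with ⟨-, h0, -⟩ | ⟨hw, -, -⟩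
    · exact h0
    · exfalso
      rw [hw1] at hw
      norm_num at hw
  -- `rank E + rank E^(d) = 1`
  have hsum := W.mordellWeilRank_add_eq_of_baseChange K h2 one_ne_zero hrk
  rw [hW0, zero_add] at hsum
  obtain ⟨Cd, rfl⟩ := hWd
  exact ⟨hW0, by rw [(W.quadraticTwist (NumberField.discr K : ℚ)).mordellWeilRank_variableChange_holds Cd, hsum]⟩

/-! ## §3 `Ш(Wd/ℚ)[2] = 0` under a 2-Selmer-minimal twin -/

/-- **`Ш(Wd/ℚ)[2] = 0` on the live configuration**: on U_T's frame with `w(E) = +1` and a 2-Selmer-minimal elliptic `ℚ`-model `Wd ≅ E^(d_K)`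
(`#Sel₂(Wd) = 2`), `#(Ш(Wd/ℚ) ∩ H¹(ℚ,Wd)[2]) = 1` — the descent count `#Sel₂(Wd) = 2^(rank Wd(ℚ)) · #Wd(ℚ)[2] · #Ш(Wd/ℚ)[2]` (AEC X.4.2,
`card_selmerGroup_eq_pow_rank_mul`) with `rank = 1` (§1) and `Wd(ℚ)[2] = 0` (§2). [cite: SilvermanAEC2009, Thm. X.4.2 (a)] [cite: MazurRubin2010, §1] -/
theorem natCard_sha_inf_torsionBy_two_twin_eq_one_onHabitat (hQ2 : KolyvaginRelationAtTwo)
    (W : WeierstrassCurve ℚ) [W.IsElliptic] [W.IsGloballyMinimal] [NeZero (W.conductorNorm ℤ)] (hcm : ¬ W.HasCM)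
    (hT : Odd W.tamagawaProduct) (v : HeightOneSpectrum (𝓞 ℚ)) (h2v : ((2 : ℕ) : 𝓞 ℚ) ∉ v.asIdeal)
    (hNv : ((W.conductorNorm ℤ : ℕ) : 𝓞 ℚ) ∈ v.asIdeal) (hmult : W.HasMultiplicativeReductionAt v) (hneg : W.Δ < 0)
    (K : Type) [Field K] [NumberField K] (hIQ : IsImaginaryQuadratic K) (hodd : Odd (NumberField.discr K))
    (h3 : NumberField.discr K ≠ -3) (hHe : SatisfiesHeegnerHypothesis (W.conductorNorm ℤ) K)
    (hsq1 : ¬ IsSquare ((NumberField.discr K : ℚ) * -|W.Δ|)) (hsq2 : ¬ IsSquare ((NumberField.discr K : ℚ) * (-(2 * |W.Δ|))))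
    (hρ : ∀ n : ℕ, 0 < n → W.HasSurjectiveModNGaloisRep ((2 : ℤ) ^ n))
    (Dt : ModularParametrizationData W (W.conductorNorm ℤ)) (β : ℤ) (ι : K →+* ℂ) (d₁ : KolyvaginHeegnerData Dt β ι 1)
    (hnt : ¬ IsOfFinAddOrder d₁.derivedPoint) (M₀ : ℕ)
    (hndiv : ¬ ∃ Q : (W.baseChange (ringClassField K ι 1)).toAffine.Point, ((2 ^ (M₀ + 1) : ℕ) : ℤ) • Q = d₁.derivedPoint)
    (hw1 : W.rootNumber = 1)
    (Wd : WeierstrassCurve ℚ) [Wd.IsElliptic] (hWd : ∃ C : VariableChange ℚ, C • W.quadraticTwist (NumberField.discr K : ℚ) = Wd)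
    (hSel : Nat.card (Wd.selmerGroup 2) = 2) :
    Nat.card (Wd.sha ⊓ AddSubgroup.torsionBy Wd.galH1 (2 : ℕ) : AddSubgroup Wd.galH1) = 1 := by
  have hrank := (mordellWeilRank_rat_eq_zero_and_twin_eq_one_onHabitat hQ2 W hcm hT v h2v hNv hmult hneg K hIQ hodd h3 hHe hsq1 hsq2 hρ Dt β ι
    d₁ hnt M₀ hndiv hw1 Wd hWd).2
  have hcount := card_selmerGroup_eq_pow_rank_mul Wd 2
  simp only [Nat.cast_ofNat] at hcount ⊢
  rw [hSel, hrank, pow_one, mul_assoc] at hcount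
  -- `2 · 1 = 2 · (#Wd(ℚ)[2] · #(Ш ∩ H¹[2]))` forces the product, hence the second factor, to be `1`
  have hcd := Nat.eq_of_mul_eq_mul_left (show 0 < 2 by norm_num) ((mul_one 2).trans hcount)
  exact Nat.eq_one_of_mul_eq_one_left hcd.symm

/-! ## §4 `Ш(Wd/ℚ)[2^∞] = 0` -/

/-- **`Ш(Wd/ℚ)[2^∞] = 0` on the live configuration** («`Zp = ⊥`»; LEAD memo R7 §1a): every class of `Ш(Wd/ℚ)` of `2`-power order is `0`, since a
non-zero one would have a multiple of order exactly `2` in `Ш(Wd/ℚ)[2] = 0` (§3).  Input of SANDWICH′ (A) (τ acts trivially on `Ш(E/K)[2^∞]`: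
`(1 − τ)X = res′ cores′ X ⊆ res′ Ш(Wd/ℚ)[2^∞] = 0`) and of the adaptive telescope's `Zp`. [cite: SilvermanAEC2009, Thm. X.4.2 (a)]
[cite: GrossLMS1991, Thm. 1.3] [cite: MazurRubin2010, §1] -/
theorem forall_primaryComponent_sha_twin_two_eq_zero_onHabitat (hQ2 : KolyvaginRelationAtTwo)
    (W : WeierstrassCurve ℚ) [W.IsElliptic] [W.IsGloballyMinimal] [NeZero (W.conductorNorm ℤ)] (hcm : ¬ W.HasCM)
    (hT : Odd W.tamagawaProduct) (v : HeightOneSpectrum (𝓞 ℚ)) (h2v : ((2 : ℕ) : 𝓞 ℚ) ∉ v.asIdeal)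
    (hNv : ((W.conductorNorm ℤ : ℕ) : 𝓞 ℚ) ∈ v.asIdeal) (hmult : W.HasMultiplicativeReductionAt v) (hneg : W.Δ < 0)
    (K : Type) [Field K] [NumberField K] (hIQ : IsImaginaryQuadratic K) (hodd : Odd (NumberField.discr K))
    (h3 : NumberField.discr K ≠ -3) (hHe : SatisfiesHeegnerHypothesis (W.conductorNorm ℤ) K)
    (hsq1 : ¬ IsSquare ((NumberField.discr K : ℚ) * -|W.Δ|)) (hsq2 : ¬ IsSquare ((NumberField.discr K : ℚ) * (-(2 * |W.Δ|))))
    (hρ : ∀ n : ℕ, 0 < n → W.HasSurjectiveModNGaloisRep ((2 : ℤ) ^ n))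
    (Dt : ModularParametrizationData W (W.conductorNorm ℤ)) (β : ℤ) (ι : K →+* ℂ) (d₁ : KolyvaginHeegnerData Dt β ι 1)
    (hnt : ¬ IsOfFinAddOrder d₁.derivedPoint) (M₀ : ℕ)
    (hndiv : ¬ ∃ Q : (W.baseChange (ringClassField K ι 1)).toAffine.Point, ((2 ^ (M₀ + 1) : ℕ) : ℤ) • Q = d₁.derivedPoint)
    (hw1 : W.rootNumber = 1)
    (Wd : WeierstrassCurve ℚ) [Wd.IsElliptic] (hWd : ∃ C : VariableChange ℚ, C • W.quadraticTwist (NumberField.discr K : ℚ) = Wd)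
    (hSel : Nat.card (Wd.selmerGroup 2) = 2) :
    ∀ x ∈ AddCommGroup.primaryComponent Wd.sha 2, x = 0 := by
  have h1 := natCard_sha_inf_torsionBy_two_twin_eq_one_onHabitat hQ2 W hcm hT v h2v hNv hmult hneg K hIQ hodd h3 hHe hsq1 hsq2 hρ Dt β ι d₁
    hnt M₀ hndiv hw1 Wd hWd hSel
  have hsub : Subsingleton (Wd.sha ⊓ AddSubgroup.torsionBy Wd.galH1 (2 : ℕ) : AddSubgroup Wd.galH1) := (Nat.card_eq_one_iff_unique.mp h1).1
  intro x hx
  by_contra hx0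
  obtain ⟨k, hk⟩ := (AddCommGroup.mem_primaryComponent).1 hx
  -- the order of `x` is `2^e` with `e ≥ 1`
  obtain ⟨e, -, he⟩ := (Nat.dvd_prime_pow Nat.prime_two).mp (addOrderOf_dvd_iff_nsmul_eq_zero.mpr hk)
  have he1 : 1 ≤ e := by
    by_contra h
    have h0 : e = 0 := by omega
    rw [h0, pow_zero, AddMonoid.addOrderOf_eq_one_iff] at he
    exact hx0 he
  -- `y = 2^(e-1) • x` has order exactly `2`
  set y : Wd.sha := 2 ^ (e - 1) • x with hy
  have hy2 : 2 • y = 0 := by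
    rw [hy, ← mul_nsmul', ← pow_succ', Nat.sub_add_cancel he1, ← he]
    exact addOrderOf_nsmul_eq_zero x
  have hy0 : y ≠ 0 := by
    intro h
    have hdvd : addOrderOf x ∣ 2 ^ (e - 1) := addOrderOf_dvd_iff_nsmul_eq_zero.mpr (by rw [← hy]; exact h)
    rw [he, Nat.pow_dvd_pow_iff_le_right (by norm_num)] at hdvd
    omega
  -- `y ∈ Ш ∩ H¹(ℚ, Wd)[2]`, a trivial group
  have hymem : ((y : Wd.sha) : Wd.galH1) ∈ (Wd.sha ⊓ AddSubgroup.torsionBy Wd.galH1 (2 : ℕ) : AddSubgroup Wd.galH1) := by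
    refine AddSubgroup.mem_inf.mpr ⟨y.2, torsionBy.nsmul_iff.mpr ?_⟩
    rw [← AddSubgroupClass.coe_nsmul, hy2, ZeroMemClass.coe_zero]
  have h0 : (⟨((y : Wd.sha) : Wd.galH1), hymem⟩ : (Wd.sha ⊓ AddSubgroup.torsionBy Wd.galH1 (2 : ℕ) : AddSubgroup Wd.galH1)) =
      ⟨0, AddSubgroup.zero_mem _⟩ := Subsingleton.elim _ _
  have hval : ((y : Wd.sha) : Wd.galH1) = 0 := congrArg Subtype.val h0
  exact hy0 (Subtype.ext hval)

/-- **`#Ш(Wd/ℚ)[2^∞] = 1` on the live configuration.** [cite: SilvermanAEC2009, Thm. X.4.2 (a)] [cite: MazurRubin2010, §1] -/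
theorem natCard_primaryComponent_sha_twin_two_eq_one_onHabitat (hQ2 : KolyvaginRelationAtTwo)
    (W : WeierstrassCurve ℚ) [W.IsElliptic] [W.IsGloballyMinimal] [NeZero (W.conductorNorm ℤ)] (hcm : ¬ W.HasCM)
    (hT : Odd W.tamagawaProduct) (v : HeightOneSpectrum (𝓞 ℚ)) (h2v : ((2 : ℕ) : 𝓞 ℚ) ∉ v.asIdeal)
    (hNv : ((W.conductorNorm ℤ : ℕ) : 𝓞 ℚ) ∈ v.asIdeal) (hmult : W.HasMultiplicativeReductionAt v) (hneg : W.Δ < 0)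
    (K : Type) [Field K] [NumberField K] (hIQ : IsImaginaryQuadratic K) (hodd : Odd (NumberField.discr K))
    (h3 : NumberField.discr K ≠ -3) (hHe : SatisfiesHeegnerHypothesis (W.conductorNorm ℤ) K)
    (hsq1 : ¬ IsSquare ((NumberField.discr K : ℚ) * -|W.Δ|)) (hsq2 : ¬ IsSquare ((NumberField.discr K : ℚ) * (-(2 * |W.Δ|))))
    (hρ : ∀ n : ℕ, 0 < n → W.HasSurjectiveModNGaloisRep ((2 : ℤ) ^ n))
    (Dt : ModularParametrizationData W (W.conductorNorm ℤ)) (β : ℤ) (ι : K →+* ℂ) (d₁ : KolyvaginHeegnerData Dt β ι 1)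
    (hnt : ¬ IsOfFinAddOrder d₁.derivedPoint) (M₀ : ℕ)
    (hndiv : ¬ ∃ Q : (W.baseChange (ringClassField K ι 1)).toAffine.Point, ((2 ^ (M₀ + 1) : ℕ) : ℤ) • Q = d₁.derivedPoint)
    (hw1 : W.rootNumber = 1)
    (Wd : WeierstrassCurve ℚ) [Wd.IsElliptic] (hWd : ∃ C : VariableChange ℚ, C • W.quadraticTwist (NumberField.discr K : ℚ) = Wd)
    (hSel : Nat.card (Wd.selmerGroup 2) = 2) :
    Nat.card (AddCommGroup.primaryComponent Wd.sha 2) = 1 := by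
  rw [Nat.card_eq_one_iff_unique]
  refine ⟨⟨fun a b ↦ Subtype.ext ?_⟩, ⟨⟨0, AddSubgroup.zero_mem _⟩⟩⟩
  have h := forall_primaryComponent_sha_twin_two_eq_zero_onHabitat hQ2 W hcm hT v h2v hNv hmult hneg K hIQ hodd h3 hHe hsq1 hsq2 hρ Dt β ι d₁
    hnt M₀ hndiv hw1 Wd hWd hSel
  rw [h a.1 a.2, h b.1 b.2]

/-! ## §5 (append) The `W.quadraticTwist (discr K)`-presentation -/

/-- **`Ш(E^(d_K)/ℚ)[2^∞] = 0` for the twist ITSELF (`W.quadraticTwist (discr K)`), on the live configuration**: if some `ℚ`-model `Wd = C • E^(d_K)`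
has `#Sel₂(Wd) = 2` then so does `E^(d_K)` (`#Sel₂` is equation-invariant, `natCard_selmerGroup_smul`), and §4 applies to `E^(d_K)` with the trivial
change of variables.  This is the presentation LEAD's (A) road uses (twist identification `H¹(K, E) ≅ H¹(K, E^(d_K))`).
[cite: SilvermanAEC2009, Thm. X.4.2 (a), III.3.1 (b)] [cite: MazurRubin2010, §1] -/
theorem forall_primaryComponent_sha_quadraticTwist_two_eq_zero_onHabitat (hQ2 : KolyvaginRelationAtTwo)
    (W : WeierstrassCurve ℚ) [W.IsElliptic] [W.IsGloballyMinimal] [NeZero (W.conductorNorm ℤ)] (hcm : ¬ W.HasCM)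
    (hT : Odd W.tamagawaProduct) (v : HeightOneSpectrum (𝓞 ℚ)) (h2v : ((2 : ℕ) : 𝓞 ℚ) ∉ v.asIdeal)
    (hNv : ((W.conductorNorm ℤ : ℕ) : 𝓞 ℚ) ∈ v.asIdeal) (hmult : W.HasMultiplicativeReductionAt v) (hneg : W.Δ < 0)
    (K : Type) [Field K] [NumberField K] (hIQ : IsImaginaryQuadratic K) (hodd : Odd (NumberField.discr K))
    (h3 : NumberField.discr K ≠ -3) (hHe : SatisfiesHeegnerHypothesis (W.conductorNorm ℤ) K)
    (hsq1 : ¬ IsSquare ((NumberField.discr K : ℚ) * -|W.Δ|)) (hsq2 : ¬ IsSquare ((NumberField.discr K : ℚ) * (-(2 * |W.Δ|))))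
    (hρ : ∀ n : ℕ, 0 < n → W.HasSurjectiveModNGaloisRep ((2 : ℤ) ^ n))
    (Dt : ModularParametrizationData W (W.conductorNorm ℤ)) (β : ℤ) (ι : K →+* ℂ) (d₁ : KolyvaginHeegnerData Dt β ι 1)
    (hnt : ¬ IsOfFinAddOrder d₁.derivedPoint) (M₀ : ℕ)
    (hndiv : ¬ ∃ Q : (W.baseChange (ringClassField K ι 1)).toAffine.Point, ((2 ^ (M₀ + 1) : ℕ) : ℤ) • Q = d₁.derivedPoint)
    (hw1 : W.rootNumber = 1)
    (Wd : WeierstrassCurve ℚ) [Wd.IsElliptic] (hWd : ∃ C : VariableChange ℚ, C • W.quadraticTwist (NumberField.discr K : ℚ) = Wd)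
    (hSel : Nat.card (Wd.selmerGroup 2) = 2) :
    haveI := W.isElliptic_quadraticTwist (show (NumberField.discr K : ℚ) ≠ 0 by exact_mod_cast NumberField.discr_ne_zero K)
    (∀ x ∈ AddCommGroup.primaryComponent (W.quadraticTwist (NumberField.discr K : ℚ)).sha 2, x = 0) ∧
      (W.quadraticTwist (NumberField.discr K : ℚ)).mordellWeilRank = 1 := by
  have hdK : (NumberField.discr K : ℚ) ≠ 0 := by exact_mod_cast NumberField.discr_ne_zero K
  haveI := W.isElliptic_quadraticTwist hdK
  obtain ⟨C, hC⟩ := hWd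
  -- `#Sel₂(E^(d_K)) = #Sel₂(Wd) = 2`
  have hSel' : Nat.card ((W.quadraticTwist (NumberField.discr K : ℚ)).selmerGroup 2) = 2 := by
    have h := natCard_selmerGroup_smul (W.quadraticTwist (NumberField.discr K : ℚ)) C (n := 2) two_ne_zero
    simp only [Nat.cast_ofNat] at h
    rw [← h, hC, hSel]
  have hWd' : ∃ C' : VariableChange ℚ, C' • W.quadraticTwist (NumberField.discr K : ℚ) = W.quadraticTwist (NumberField.discr K : ℚ) :=
    ⟨1, one_smul _ _⟩
  exact ⟨forall_primaryComponent_sha_twin_two_eq_zero_onHabitat hQ2 W hcm hT v h2v hNv hmult hneg K hIQ hodd h3 hHe hsq1 hsq2 hρ Dt β ι d₁ hnt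
      M₀ hndiv hw1 (W.quadraticTwist (NumberField.discr K : ℚ)) hWd' hSel',
    (mordellWeilRank_rat_eq_zero_and_twin_eq_one_onHabitat hQ2 W hcm hT v h2v hNv hmult hneg K hIQ hodd h3 hHe hsq1 hsq2 hρ Dt β ι d₁ hnt M₀
      hndiv hw1 (W.quadraticTwist (NumberField.discr K : ℚ)) hWd').2⟩

end Summit.BirchSwinnertonDyer.BirchSwinnertonDyer.Theorems.GenusExact.PlusDescent

end
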